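import Summits.BirchSwinnertonDyer.BirchSwinnertonDyer.Theorems.CMKolyvaginAtInertTwoGenusDefectBSDConsistencyAtTwo
import Summits.BirchSwinnertonDyer.BirchSwinnertonDyer.Theorems.GenusKolyvaginAtTwoPowDvdShaCardAtTwoRTBottomRungParity
import Summits.BirchSwinnertonDyer.BirchSwinnertonDyer.Theses.CMKolyvaginAtInertTwo
import HarnessLib

/-!
# Crux `CMKolyvaginConjectureAtInertTwo` (stmt-BirchSwinnertonDyer-24648), open stub `stub_positiveDepth`:
# UNDER BSD₂(E), ON A HEEGNER FIELD WITH GENUS DEFECT `Σ ≥ 2`, EVERY DEEP DERIVED POINT IS `2`-DIVISIBLE —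
# so a witness of the crux there must be SHALLOW (BSD-consistency constraint, modulo the cell's five prints)

Route `CMKolyvaginAtInertTwo` (cell `pub/bsd-eis`, seat `leafhand-bsd-cmkolyvaginatinert-2` g0); helper (`--supports
stmt-BirchSwinnertonDyer-24648 --as helper`). THEOREMS ONLY (no definition, no named fact, no `sorry`); closes nothing.
`BSDp W 2` is a HYPOTHESIS of every theorem here: these are CONSISTENCY statements (what the conjecture forces on the crux's
objects), for the planner's restatement decision (Σ ≤ 1 / prime `|d_K|`, TURNKEY of cmk2 g22) — BSD is proved for no curve.

CONTEXT. The sister crux 24277's cell files (`bsd-line-cmk2-p1` g20/g21) prove: on H₂, over a Heegner field `K` with odd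
`d_K ≠ −3` and genus defect `Σ = Σ_{q∣d_K}([(Δ/q) = −1] + 2·[(Δ/q) = 1 ∧ 2 ∣ a_q]) ≥ 2`, a level-`4` Gross witness at a DEEP
square-free level `n₀` (all `ℓ ∣ n₀` Zhang–Kolyvagin at `2` with `M(ℓ) ≥ 2` and `Frob_ℓ = Frob_∞` on `K(E[4])`) contradicts
`BSDp W 2` modulo Gross–Zagier / GZK / modularity / Milne / Burungale–Flach and Gross's Prop. 3.7 (2)
(`KolyvaginGenusTwo.not_bsdp_of_grossWitness_of_two_le_sum_defect_of_prints`), and that `P(n₀) ∉ 2E(K[n₀])` IS such a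
witness (McCallum Cor. 4.5 at `2`, `GenusExact.RelaxedCount.addOrderOf_kolyvaginClass_two_eq_pow_of_not_two_dvd_single`).
This file reads the two off for crux 24648:

* `two_dvd_derivedPoint_of_deep_of_bsdp_of_prints` — **BSD₂(E) + the prints ⟹ `P(n₀) ∈ 2E(K[n₀])` for EVERY datum at
  EVERY deep square-free level `n₀`**, on an H₂ frame over a Heegner field with `Σ ≥ 2` (odd Manin constant, `y_K = P(1)`
  non-torsion of exact exponent `M₀` in `E(K[1])`).
* `two_dvd_derivedPoint_one_of_bsdp_of_prints` — the level-`1` case: **BSD₂(E) + the prints ⟹ `P(1) = y_K ∈ 2E(K[1])`**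
  on every such frame (`n₀ = 1` has no prime factors), i.e. `Σ ≥ 2` frames have POSITIVE depth and the crux's `n = 1` branch
  (`stub_levelOne`, p605855) never fires there.
* `exists_shallow_witness_of_cmKolyvaginConjectureAtInertTwo_of_bsdp_of_prints` — hence **the crux
  `CMKolyvaginConjectureAtInertTwo` (BY NAME), granted BSD₂(E) and the prints, produces on every such frame a witness
  `(n, d)` with a SHALLOW prime factor**: some `ℓ ∣ n` has `M(ℓ) < 2` (i.e. `ℓ ≡ 1 (mod 4)`, as `a_ℓ = 0`) or
  `Frob_ℓ ≠ Frob_∞` on `K(E[4])` (in particular `n ≠ 1`).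
  The kernel thus locates exactly where the crux as typed lives off `Σ ≤ 1`: in the SHALLOW classes `c_1(n) ∈ H¹(K, E[2])`,
  which Kolyvagin's `M`-descent (levels with `M(n) ≥ 2`) never sees — the residue the planner's Σ ≤ 1 restatement removes.

HONEST FRAMING: three compositions of landed theorems; conditional on `BSDp W 2` and five named prints by design; no stub is
closed; BSD is proved for no curve.
References: [cite: McCallumLMS1991, §4 Cor. 4.5, §5 Thm. 5.4] [cite: GrossLMS1991, Prop. 3.7 (2), §4 (4.1)]
[cite: BurungaleFlach2024, Thm. 1.1] [cite: Kramer1981, Prop. 3] [cite: WZhang2014, §3.7 (M(n), Λ)]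
-/

set_option linter.dupNamespace false -- `Summit.BirchSwinnertonDyer.BirchSwinnertonDyer.Theorems.…` (summit = sub)
set_option autoImplicit false

noncomputable section

open scoped Classical

namespace Summit.BirchSwinnertonDyer.BirchSwinnertonDyer.Theorems.CMKolyvaginConjecturePositiveDepth

open WeierstrassCurve NumberField Literature.NumberTheory.EllipticCurves
  Literature.NumberTheory.EllipticCurves.ModularForms
  Literature.NumberTheory.EllipticCurves.Rank1Residual
  Literature.NumberTheory.EllipticCurves.Rank1Residual.Typed
  Literature.NumberTheory.EllipticCurves.KrizLi2019
  Literature.NumberTheory.GaloisRepresentations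
  Summit.BirchSwinnertonDyer.Rank1Residual
  Summit.BirchSwinnertonDyer.Rank1Residual.AdditivePotMult
open Literature.NumberTheory.EllipticCurves.GrossLMS1991 (prop37_2_reductionCongruence_inert)
open Summit.BirchSwinnertonDyer.BirchSwinnertonDyer.Theses.CMKolyvaginAtInertTwo (CMKolyvaginConjectureAtInertTwo)
open Summit.BirchSwinnertonDyer.BirchSwinnertonDyer.Theorems
open Summit.BirchSwinnertonDyer.BirchSwinnertonDyer.Theorems.GenusExact
open Summit.BirchSwinnertonDyer.BirchSwinnertonDyer.Theorems.KolyvaginGenusTwo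

/-- **BSD₂(E) ⟹ every DEEP derived point is `2`-divisible on a `Σ ≥ 2` Heegner field** (modulo the five prints and Gross's
Prop. 3.7 (2)). On H₂ (`W/ℚ` globally minimal with CM, `2` inert in the CM field, `ρ̄_{E,2}` onto, `r_an(E) = 1`, odd
Tamagawa product), `K` imaginary quadratic with odd `d_K ≠ −3`, Heegner for `N_E` and genus defect `Σ ≥ 2`, a frame `Dt` with
odd Manin constant, `y_K = P(1)` non-torsion with `2^{M₀} ∥ P(1)` in `E(K[1])`: if `BSDp W 2` holds then for every square-free
`n₀` all of whose prime factors `ℓ` are Zhang–Kolyvagin primes at `2` with `M(ℓ) ≥ 2` and `Frob_ℓ = Frob_∞` on `K(E[4])`, and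
every datum `e₀` of conductor `n₀`, **`P_{e₀}(n₀) ∈ 2E(K[n₀])`** — otherwise McCallum's Cor. 4.5 makes `c₂(e₀)` a level-`4`
Gross witness and `KolyvaginGenusTwo.not_bsdp_of_grossWitness_of_two_le_sum_defect_of_prints` refutes `BSDp W 2`.
[cite: McCallumLMS1991, §4 Cor. 4.5, §5 Thm. 5.4] [cite: BurungaleFlach2024, Thm. 1.1] [cite: Kramer1981, Prop. 3] -/
theorem two_dvd_derivedPoint_of_deep_of_bsdp_of_prints
    (hGZ : ∀ (N : ℕ) [NeZero N] (W : WeierstrassCurve ℚ) (K : Type) [Field K] [NumberField K], gross_zagier N W K)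
    (hGZK : rank_eq_analyticRank_of_analyticRank_le_one) (hnf : exists_isNewformOf)
    (hMilneC : Milne1972.bsdQuotient_baseChange_quadratic_anyModel) (hBF : bsdTriple_of_hasCM_of_L_one_ne_zero)
    (W : WeierstrassCurve ℚ) [W.IsElliptic] [W.IsGloballyMinimal] [NeZero (W.conductorNorm ℤ)]
    (hCM : W.HasCM) (hin : Rank1Residual.CMInert W 2) (hρ2 : W.HasSurjectiveModNGaloisRep 2) (hr : W.analyticRank = 1)
    (hT : Odd W.tamagawaProduct) (K : Type) [Field K] [NumberField K] (hIQ : IsImaginaryQuadratic K)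
    (hodd : Odd (NumberField.discr K)) (h3 : NumberField.discr K ≠ -3) (hHe : SatisfiesHeegnerHypothesis (W.conductorNorm ℤ) K)
    (h37 : prop37_2_reductionCongruence_inert (W.conductorNorm ℤ) W K)
    (Dt : ModularParametrizationData W (W.conductorNorm ℤ)) (hc : Odd Dt.c) (β : ℤ) (ι : K →+* ℂ) (d₁ : KolyvaginHeegnerData Dt β ι 1)
    (hy : ¬ IsOfFinAddOrder d₁.derivedPoint) (M₀ : ℕ)
    (hM₀ : ∃ Q : (W.baseChange (ringClassField K ι 1)).toAffine.Point, ((2 ^ M₀ : ℕ) : ℤ) • Q = d₁.derivedPoint)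
    (hndiv : ¬ ∃ Q : (W.baseChange (ringClassField K ι 1)).toAffine.Point, ((2 ^ (M₀ + 1) : ℕ) : ℤ) • Q = d₁.derivedPoint)
    (hS2 : 2 ≤ ∑ q ∈ (NumberField.discr K).natAbs.primeFactors,
        ((if jacobiSym W.Δ.num q = -1 then 1 else 0) +
          (if jacobiSym W.Δ.num q = 1 ∧ Even (W.frobeniusTrace q) then 2 else 0)))
    (hBW : BSDp W 2)
    {n₀ : ℕ} (hn₀ : Squarefree n₀)
    (hn₀K : ∀ q ∈ n₀.primeFactors, Zhang2014.IsKolyvaginPrime (W.conductorNorm ℤ) W K 2 q ∧ 2 ≤ Zhang2014.kolyvaginIndex W 2 q ∧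
      FrobEqFrobInfty W K (2 ^ 2) q)
    (e₀ : KolyvaginHeegnerData Dt β ι n₀) :
    ∃ Q : (W.baseChange (ringClassField K ι n₀)).toAffine.Point, (2 : ℤ) • Q = e₀.derivedPoint := by
  by_contra hPn₀
  haveI : ∀ j : ℕ, NumberField (ringClassField K ι j) := JET.numberField_ringClassField K hIQ ι
  have he₀ : addOrderOf (e₀.kolyvaginClass Nat.prime_two 2) = 2 ^ 2 :=
    RelaxedCount.addOrderOf_kolyvaginClass_two_eq_pow_of_not_two_dvd_single W hIQ hodd h3 hHe hρ2 Dt β ι (M := 2) (by norm_num) hn₀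
      (fun q hq ↦ ⟨(hn₀K q hq).1, (hn₀K q hq).2.1⟩) e₀ hPn₀
  exact not_bsdp_of_grossWitness_of_two_le_sum_defect_of_prints hGZ hGZK hnf hMilneC hBF W hCM hin hρ2 hr hT K hIQ hodd h3 hHe h37
    Dt hc β ι d₁ hy M₀ hM₀ hndiv hn₀ hn₀K e₀ he₀ hS2 hBW

/-- **Granted BSD₂(E) and the prints, `y_K = P(1) ∈ 2E(K[1])` on every `Σ ≥ 2` Heegner field** — the level-`1` case
(`n₀ = 1`, no prime factors, every conductor-`1` datum) of `two_dvd_derivedPoint_of_deep_of_bsdp_of_prints`: on such frames the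
depth is POSITIVE, i.e. the crux's `n = 1` branch (`stub_levelOne`, p605855) never fires there. Same hypotheses.
[cite: McCallumLMS1991, §4 Cor. 4.5, §5 Thm. 5.4] [cite: GrossZagier1986, V.§2 (2.2)] [cite: Kramer1981, Prop. 3] -/
theorem two_dvd_derivedPoint_one_of_bsdp_of_prints
    (hGZ : ∀ (N : ℕ) [NeZero N] (W : WeierstrassCurve ℚ) (K : Type) [Field K] [NumberField K], gross_zagier N W K)
    (hGZK : rank_eq_analyticRank_of_analyticRank_le_one) (hnf : exists_isNewformOf)
    (hMilneC : Milne1972.bsdQuotient_baseChange_quadratic_anyModel) (hBF : bsdTriple_of_hasCM_of_L_one_ne_zero)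
    (W : WeierstrassCurve ℚ) [W.IsElliptic] [W.IsGloballyMinimal] [NeZero (W.conductorNorm ℤ)]
    (hCM : W.HasCM) (hin : Rank1Residual.CMInert W 2) (hρ2 : W.HasSurjectiveModNGaloisRep 2) (hr : W.analyticRank = 1)
    (hT : Odd W.tamagawaProduct) (K : Type) [Field K] [NumberField K] (hIQ : IsImaginaryQuadratic K)
    (hodd : Odd (NumberField.discr K)) (h3 : NumberField.discr K ≠ -3) (hHe : SatisfiesHeegnerHypothesis (W.conductorNorm ℤ) K)
    (h37 : prop37_2_reductionCongruence_inert (W.conductorNorm ℤ) W K)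
    (Dt : ModularParametrizationData W (W.conductorNorm ℤ)) (hc : Odd Dt.c) (β : ℤ) (ι : K →+* ℂ) (d₁ : KolyvaginHeegnerData Dt β ι 1)
    (hy : ¬ IsOfFinAddOrder d₁.derivedPoint) (M₀ : ℕ)
    (hM₀ : ∃ Q : (W.baseChange (ringClassField K ι 1)).toAffine.Point, ((2 ^ M₀ : ℕ) : ℤ) • Q = d₁.derivedPoint)
    (hndiv : ¬ ∃ Q : (W.baseChange (ringClassField K ι 1)).toAffine.Point, ((2 ^ (M₀ + 1) : ℕ) : ℤ) • Q = d₁.derivedPoint)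
    (hS2 : 2 ≤ ∑ q ∈ (NumberField.discr K).natAbs.primeFactors,
        ((if jacobiSym W.Δ.num q = -1 then 1 else 0) +
          (if jacobiSym W.Δ.num q = 1 ∧ Even (W.frobeniusTrace q) then 2 else 0)))
    (hBW : BSDp W 2) (d : KolyvaginHeegnerData Dt β ι 1) :
    ∃ Q : (W.baseChange (ringClassField K ι 1)).toAffine.Point, (2 : ℤ) • Q = d.derivedPoint :=
  two_dvd_derivedPoint_of_deep_of_bsdp_of_prints hGZ hGZK hnf hMilneC hBF W hCM hin hρ2 hr hT K hIQ hodd h3 hHe h37 Dt hc β ι d₁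
    hy M₀ hM₀ hndiv hS2 hBW squarefree_one (fun q hq ↦ absurd hq (by simp [Nat.primeFactors_one])) d

/-- **Granted BSD₂(E) and the prints, a witness of crux 24648 on a `Σ ≥ 2` frame is SHALLOW.** If
`CMKolyvaginConjectureAtInertTwo` holds (hypothesis `hKC`, the crux BY NAME), then on every H₂ frame as in
`two_dvd_derivedPoint_of_deep_of_bsdp_of_prints` which moreover satisfies the crux's frame clauses (`Dt` optimal:
`Λ_{Dt} = c·Λ_f`, odd `c`), the crux's witness `(n, d)` — `n` square-free with CM-inert Zhang–Kolyvagin prime factors,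
`P_d(n) ∉ 2E(K[n])` — has a prime factor `ℓ` with `M(ℓ) < 2` (i.e. `ℓ ≡ 1 (mod 4)`, as `a_ℓ = 0`) or `Frob_ℓ ≠ Frob_∞` on
`K(E[4])`; in particular `n ≠ 1` (the frame has positive depth, `two_dvd_derivedPoint_one_of_bsdp_of_prints`). An all-deep `n`
(including `n = 1`) is excluded by `two_dvd_derivedPoint_of_deep_of_bsdp_of_prints`.
[cite: McCallumLMS1991, §4 Cor. 4.5, §5 Thm. 5.4] [cite: WZhang2014, §3.7 (M(n), Λ)] [cite: GrossLMS1991, §4 (4.1)] -/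
theorem exists_shallow_witness_of_cmKolyvaginConjectureAtInertTwo_of_bsdp_of_prints
    (hGZ : ∀ (N : ℕ) [NeZero N] (W : WeierstrassCurve ℚ) (K : Type) [Field K] [NumberField K], gross_zagier N W K)
    (hGZK : rank_eq_analyticRank_of_analyticRank_le_one) (hnf : exists_isNewformOf)
    (hMilneC : Milne1972.bsdQuotient_baseChange_quadratic_anyModel) (hBF : bsdTriple_of_hasCM_of_L_one_ne_zero)
    (hKC : CMKolyvaginConjectureAtInertTwo)
    (W : WeierstrassCurve ℚ) [W.IsElliptic] [W.IsGloballyMinimal] [NeZero (W.conductorNorm ℤ)]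
    (hCM : W.HasCM) (hin : Rank1Residual.CMInert W 2) (hρ2 : W.HasSurjectiveModNGaloisRep 2) (hr : W.analyticRank = 1)
    (hT : Odd W.tamagawaProduct) (K : Type) [Field K] [NumberField K] (hIQ : IsImaginaryQuadratic K)
    (hodd : Odd (NumberField.discr K)) (h3 : NumberField.discr K ≠ -3) (hHe : SatisfiesHeegnerHypothesis (W.conductorNorm ℤ) K)
    (h37 : prop37_2_reductionCongruence_inert (W.conductorNorm ℤ) W K)
    (Dt : ModularParametrizationData W (W.conductorNorm ℤ))
    (hDt : ∀ z ∈ Dt.L.lattice, ∃ w ∈ periodLattice Dt.f, z = (Dt.c : ℂ) * w) (hc : Odd Dt.c)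
    (β : ℤ) (ι : K →+* ℂ) (d₁ : KolyvaginHeegnerData Dt β ι 1)
    (hy : ¬ IsOfFinAddOrder d₁.derivedPoint) (M₀ : ℕ)
    (hM₀ : ∃ Q : (W.baseChange (ringClassField K ι 1)).toAffine.Point, ((2 ^ M₀ : ℕ) : ℤ) • Q = d₁.derivedPoint)
    (hndiv : ¬ ∃ Q : (W.baseChange (ringClassField K ι 1)).toAffine.Point, ((2 ^ (M₀ + 1) : ℕ) : ℤ) • Q = d₁.derivedPoint)
    (hS2 : 2 ≤ ∑ q ∈ (NumberField.discr K).natAbs.primeFactors,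
        ((if jacobiSym W.Δ.num q = -1 then 1 else 0) +
          (if jacobiSym W.Δ.num q = 1 ∧ Even (W.frobeniusTrace q) then 2 else 0)))
    (hBW : BSDp W 2) :
    ∃ (n : ℕ) (d : KolyvaginHeegnerData Dt β ι n), Squarefree n ∧
      (∀ ℓ ∈ n.primeFactors, Zhang2014.IsKolyvaginPrime (W.conductorNorm ℤ) W K 2 ℓ ∧ Rank1Residual.CMInert W ℓ) ∧
      (¬ ∃ Q : (W.baseChange (ringClassField K ι n)).toAffine.Point, (2 : ℤ) • Q = d.derivedPoint) ∧
      ∃ ℓ ∈ n.primeFactors, Zhang2014.kolyvaginIndex W 2 ℓ < 2 ∨ ¬ FrobEqFrobInfty W K (2 ^ 2) ℓ := by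
  obtain ⟨n, d, hn, hKol, hP⟩ := hKC W hCM hin hρ2 hr hT K hIQ hodd h3 hHe Dt hDt hc β ι d₁ hy
  refine ⟨n, d, hn, hKol, hP, ?_⟩
  by_contra hdeep
  push Not at hdeep
  exact hP (two_dvd_derivedPoint_of_deep_of_bsdp_of_prints hGZ hGZK hnf hMilneC hBF W hCM hin hρ2 hr hT K hIQ hodd h3 hHe h37
    Dt hc β ι d₁ hy M₀ hM₀ hndiv hS2 hBW hn (fun q hq ↦ ⟨(hKol q hq).1, hdeep q hq⟩) d)

end Summit.BirchSwinnertonDyer.BirchSwinnertonDyer.Theorems.CMKolyvaginConjecturePositiveDepth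

end
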